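/-
COR-CM (cells pub-hodgecm / pub-hodgecm2, stage 2 of the Hodge ladder) — TRANSPOSITION SURGE, item (vi) sub-binder S2 / (vi-2)
`supply`: the INTEGRATED display at the Appendix-C datum ALONG `ῑ₁ = conj ∘ ι₁` (package P2′) with BOTH pinning halves SUBSTITUTED BY
NAME — TEAM hComp's `Model.hUnif_holds` / `Model.hAlb_holds` and TEAM hCMisogE's σ-parametric Core theorem
`Model.exists_isogeny_isCMTypeRealisation_baseChange_of_det45` (pin-3 = prover-pub-hodgecm2-pin-3-g2-0, the integrator; ROUTE (B) per
TEAM hComp's word pub-hodgecm2/INBOX 2026-08-21T21:14:01Z and b28 §T20/§T21, whose kernel fit `b28_T20_faceSupply_conj_of_det45σ` this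
file lands).  Composes BY NAME pin-3's `Model.faceSupply_of_thm418AsPrinted_glue_unif_along` (`Item6SupplyPinnedAssemblyAlong.lean`,
p303619 ✔) with the named theorems above and tr-prover-6's `Model.hc_cm_of_supply_of_dictionary_of_eq` (`Item6HoldsRec.lean`).
Theorems only: no definition, no instance, no named fact, no `variable`, nothing asserted, no proof holes; nothing landed is edited
or restated.  FRAMING: HC_CM is NOT proved; S2 = B01-S is NOT inhabited by this file (its binders are listed below).
-/
import Summits.HodgeConjecture.CorCM.B01.Transposition.Item6SupplyPinnedAssemblyAlong
import Summits.HodgeConjecture.CorCM.B01.Transposition.HComp.HUnifHolds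
import Summits.HodgeConjecture.CorCM.B01.Transposition.HComp.HAlbHolds
import Summits.HodgeConjecture.CorCM.B01.Transposition.HComp.HonestP5Of
import Summits.HodgeConjecture.CorCM.B01.Transposition.Item6PinMatchDef45
import Summits.HodgeConjecture.CorCM.B01.Transposition.Item2HoldsConj
import Literature.NumberTheory.Automorphic.Liu2021.Def45EtaConjugate
import Summits.HodgeConjecture.CorCM.B01.FaceWedgeOverlapBypassMeeting
import Literature.AlgebraicGeometry.Motives.AbelianVarietyCotangentBaseChangeIso
import Literature.AlgebraicGeometry.HodgeTheory.AbelianVarietyCotangentHodgeHolds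
import HarnessLib

/-!
# Item (vi) S2 / HC_CM from [Liu 2021, Thm. 4.18] AS PRINTED at the Appendix-C datum along `ῑ₁ = conj ∘ ι₁`, BOTH pinning halves BY NAME

The team-facing display `Model.faceSupply_of_thm418AsPrinted_glue_unif_along` (`Item6SupplyPinnedAssemblyAlong.lean` §2, p303619 ✔)
derives B01-S (`U.FaceSupply`) from [Liu2021] Thm. 4.18 EXACTLY AS PRINTED at `toThm418Data (C …) (R …)` for a free embedding family
`e` and a free Prop. C.5 datum `P5`, with three READING binders: `hUnif` + `hAlb` (TEAM hComp's REACH half) and `hCMisogσ` (TEAM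
hCMisogE's CM half at `σ = e ι₁`).  THIS FILE instantiates it at THE PACKAGE OF RECORD P2′ — `e := fun _ ι₁ ↦ (starRingEnd ℂ).comp ι₁`,
`P5 := Model.honestP5Of h` (TEAM hComp's HONEST Prop. C.5 datum: `G := ↥V.adelicFin`, `fix := refl`, the canonical-model record of
[Deligne 1979 §2.1.2, 2.2.1–2.2.5] as the `Sh` slot; `HComp/HonestP5Of.lean`, b25) — and SUBSTITUTES the three readings BY NAME:
* `hUnif := Model.hUnif_holds h` (`HComp/HUnifHolds.lean`, pin-1 over htheta-x1's `RecordSystem.pieces`, hcomp-level's `HComp.Λ`,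
  b25's `honestP5Of_slotIsoConj`; [Deligne1979 §2.1.2 + 2.2.5]) — `h : exists_recordSystem` is the ONE cited fact of the Shimura side
  (`Literature/AlgebraicGeometry/ShimuraVarieties/UnitaryShimuraCanonicalModel.lean`, x1 v5 p300664 ✔);
* `hAlb := Model.hAlb_holds hA (fun _ ι₁ ↦ (starRingEnd ℂ).comp ι₁) (honestP5Of h) iso C` (`HComp/HAlbHolds.lean`, hcomp-abcm-1, p302797 ✔)
  — `hA : Liu2021.albanese_baseChange_isLimit_fan_jacobian` is the ONE cited fact of the Albanese side ([Liu2021] §2.1 Prop. 2.2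
  l. 1190–1200 + Lem. 2.4 (1) l. 1210; [FGA VI Thm. 3.3 (iii)]; `Liu2021/AlbaneseBaseChange.lean` p302423 ✔);
* `hCMisogσ :=` hcmisog-isog-2's σ-PARAMETRIC Core theorem `Model.exists_isogeny_isCMTypeRealisation_baseChange_of_det45`
  (`Item6PinMatchDef45.lean` :129, p301919 ✔) at `σ := (starRingEnd ℂ).comp ι₁`, with its two generic inputs DISCHARGED BY NAME —
  `hW := cotangent_hodge10_comparison_holds` (TRACK 2, `HodgeTheory/AbelianVarietyCotangentHodgeHolds.lean` p302876 ✔: «`H^{1,0}` of a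
  complex abelian variety is its cotangent space at the origin, `End`-equivariantly», [LangeBirkenhake1992 §1.1]) and
  `hdetBC := AbelianVariety.det_cotangentMap_baseChange` (b17, `Motives/AbelianVarietyCotangentBaseChangeIso.lean` ✔, [GortzWedhorn2020
  Rem. 6.12]) — leaving Liu's Def. 4.5 (2) DATA on the consumer's `A_μ`, READ AT `ι₁` EXACTLY AS IN THE RECORD DISPLAY
  `Item6SupplyPinnedDef45.lean` (p305040 ✔, TEAM hCMisogE): the rational CM structure `i`, `hdim`, and the first bullet `hdet45` with
  `η_μ = Def45.eta (AlgHom.id ℚ F) ι₁ …`; the Core theorem at `σ := ῑ₁` asks for the same clause with `Def45.eta … ῑ₁ …`, and the two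
  AGREE by `Def45.eta_starRingEnd_comp_apply` («`η_μ` does not see `ι ↦ conj ∘ ι`»: `Φ_μ ∘ c = Φ_μ^c`, [Liu2021] Def. 4.5 (1) l. 1939–1942;
  `Liu2021/Def45EtaConjugate.lean`, hcomp-abcm-2; independently hcmisog-isog-2's `Def45.eta_conj_comp`) — b28 §T20's embedding-convention
  item RESOLVED, no `ῑ₁`-reading remains; likewise the CHOICE `hμ` (`Φ_μ = Φ^{*ι₁}`, pin-2's text of `Item6PinMatch.lean` :195) is moved
  to `ῑ₁` inside the proof by tr-prover-2's `isInverse_starRingEnd_comp_iff` (`Item2HoldsConj.lean` ✔).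
WHY `ῑ₁` and not `ι₁` (TEAM hComp 21:14:01Z (4)): Liu's `E ⊂ ℂ` enters Appendix C through the complex embedding at which `V` has
signature `(n−1, 1)`; in the tree's `HermSpace3 F ι₁` conventions that embedding is `ῑ₁ = conj ∘ ι₁` (TEAM hComp ARCH
`isAbove_restr_starRingEnd_comp`, `HComp/ArchimedeanSignatures.lean` p301868 ✔), so P2′ is the as-printed reading for the App-C datum of
record; the `ι₁` route would need the conjugate Hermitian space's record (HCOMP-TABLE §2, not built).

RESULTING BINDER FAMILY (b28 §T20 `#cone_binders!` on the staged bytes; each face-guarded `IsGalois ℚ F → 6 ≤ [F:ℚ] → ι₁ ∈ Φ.1` where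
printed so): the summit's standing `hHD hI h₁ h₃`; the two CITES `h`, `hA`; the consumer's POSITED Appendix-C carriers `iso`,
`C : Sec42Data (honestP5Of h …) (iso …)` (§4.2 l. 2053–2074: `X_K`, `A_K := Alb_{X_K}` over `E`; INHABITED fibrewise at `4 ≤ [F:ℚ]` from
`Liu2021.exists_albanese` by b25's `Model.nonempty_sec42Data_honestP5Of`, staged) and `R : Thm418Rest (C …)` (the rest of Thm. 4.18's
data, «`A_μ` is an abelian variety over `E`» Def. 4.5 (2) l. 1946); THE CITE `hLiu` ([Liu2021] Thm. 4.18 AS PRINTED, l. 2232–2245);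
`hObj` (Prop. 4.6 (1) l. 1969), `hChi`/`hirr`/`hsm` (Def. 4.11 l. 2090–2096); the CHOICE `hμ` (`Φ_μ = Φ^{*ι₁}`); Def. 4.5 (2) data
`i`/`hdim`/`hdet45` at `ι₁` (l. 1944–1951) — and, for the END display, `hD` (items (iii)+(v), `Item6HoldsRec.lean` :211–226 VERBATIM).
The CM-side family {`hμ`, `i`, `hdim`, `hdet45`} is the record display's (p305040) TOKEN FOR TOKEN modulo `D ↦ toThm418Data (C …) (R …)`,
`Aμ₀ … Dμ ↦ (R …).Aμ Dμ`.
NO `hComp`/`hUnif`/`hTree`/`hAlb`/`hReach`/`homE`/`hE`/`hCM`/`hCMisog*`/`hW`/`hdetBC` binder remains.  STRENGTH: ⟹ B01-S; class O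
(the Liu-side binders at this datum force `F`-models — x2 g4 EPIN-T1); no «↔ B01-S» is possible or claimed.  HC_CM is NOT proved:
`h`, `hA`, `hLiu`, the Liu-side carriers/readings and `hD` are NOT inhabited here; NOT claimed: that Liu's `X_K` / `A_K` / `A_μ` are
constructed.

References: Y. Liu, arXiv:2102.11518 = Camb. J. Math. 9 (2021) (`FJcycle.tex` md5 6db49a74122d): §2.1 l. 1185–1211, Def. 4.3 (2) l. 1919,
Def. 4.5 l. 1936–1964, Prop. 4.6 (1) l. 1969, §4.2 l. 2053–2076, Def. 4.11 l. 2083–2097, Thm. 4.18 l. 2232–2245, App. C l. 4583–4637.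
P. Deligne, *Variétés de Shimura* (Corvallis 1979) §2.1.2, 2.2.1–2.2.5.  G. Shimura, *Abelian Varieties with CM* (1998) §5.2, §6.2 Thm. 3,
§7.1 Prop. 7, §8.3 Prop. 28.  H. Lange, Ch. Birkenhake, *Complex Abelian Varieties* (1992) §1.1.  U. Görtz, T. Wedhorn, *Algebraic
Geometry I* (2020) Rem. 6.12.
-/

noncomputable section

open scoped TensorProduct InnerProductSpace

namespace Summit.HodgeConjecture.CorCM.Model

open CategoryTheory CategoryTheory.Limits AlgebraicGeometry NumberField
open Literature.AlgebraicGeometry.Motives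
open Literature.AlgebraicGeometry.Motives.HodgeStructure (conj)
open Literature.AlgebraicGeometry.HodgeTheory
open Literature.AlgebraicGeometry.ShimuraVarieties
open Literature.AlgebraicGeometry.ShimuraVarieties.UnitaryCanonicalModel
open Literature.AlgebraicGeometry.ComplexMultiplication (IsCMTypeRealisation)
open Literature.NumberTheory.ComplexMultiplication
open Literature.NumberTheory.Automorphic
open Literature.NumberTheory.Automorphic.IdeleClassGroup
open Literature.NumberTheory.Automorphic.PicardCM
open Literature.NumberTheory.Automorphic.Liu2021
open Literature.NumberTheory.Automorphic.Liu2021.AppendixC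

/-! ## §1  B01-S at the honest Appendix-C datum along `ῑ₁`, both pinning halves substituted by name -/

/-- **B01-S from [Liu 2021, Thm. 4.18] AS PRINTED at the APPENDIX-C DATUM OF RECORD** (`P5 := honestP5Of h`, pin
`A_μ ⊗_{E,ῑ₁} ℂ`, `ῑ₁ = (starRingEnd ℂ).comp ι₁`; `U = picardCMUniverse hHD hI h₁ h₃`), **the REACH half and the CM half supplied BY NAME**:
= `faceSupply_of_thm418AsPrinted_glue_unif_along` (p303619) at `e := fun _ ι₁ ↦ (starRingEnd ℂ).comp ι₁`, `P5 := honestP5Of h`, with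
`hUnif := hUnif_holds h` [TEAM hComp, pin-1], `hAlb := hAlb_holds hA _ (honestP5Of h) iso C` [TEAM hComp, hcomp-abcm-1], and
`hCMisogσ := exists_isogeny_isCMTypeRealisation_baseChange_of_det45 cotangent_hodge10_comparison_holds det_cotangentMap_baseChange ῑ₁ …`
[TEAM hCMisogE, hcmisog-isog-2].  Remaining binders: the cites `h` ([Deligne1979] canonical model, `exists_recordSystem`) and `hA`
([Liu2021] §2.1 + [FGA VI 3.3 (iii)], `albanese_baseChange_isLimit_fan_jacobian`); the posited carriers `iso`, `C`, `R`; THE CITE `hLiu`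
(Thm. 4.18, l. 2232–2245) with `hObj` (Prop. 4.6 (1)), `hChi`/`hirr`/`hsm` (Def. 4.11); the choice `hμ` (`Φ_μ = Φ^{*ι₁}`); Liu's Def. 4.5 (2)
data on `A_μ` READ AT `ι₁` (the record display's texts) — `i` («`i_μ : M_μ → End_E(A_μ)_ℚ` is a CM structure», l. 1948), `hdim`
(`[M_μ:ℚ] = 2 dim A_μ`), `hdet45` (first bullet l. 1950 on the cotangent space `Lie_E(A_μ)^∨`, `η_μ` DEFINED by `Def45.eta … ι₁`).  The
passage `ι₁ ↦ ῑ₁` inside the proof is `isInverse_starRingEnd_comp_iff` (choice) and `Def45.eta_starRingEnd_comp_apply` (first bullet).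
HC_CM is NOT proved; none of these is inhabited here.
[cite: Liu2021, Thm. 4.18 (FJcycle.tex l. 2232–2245), Def. 4.5 (1)–(2) (l. 1936–1951), §4.2 l. 2053–2074 and Prop. C.5 (l. 4627–4637)]
[cite: Deligne1979ShimuraVarieties, §2.1.2 and 2.2.5] -/
theorem faceSupply_of_thm418AsPrinted_along_conj_holds
    (hHD : exists_isReal_hodgeModel) (hI : hodgePQ_independent_of_hodgeModel)
    (h₁ : BallQuotientUniformised) (h₃ : CMAbelianVarietyRealised)
    (h : exists_recordSystem) (hA : albanese_baseChange_isLimit_fan_jacobian)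
    (iso : ∀ (F : CMField) (ι₁ : F →+* ℂ) (_ : HermSpace3 F ι₁) (_ : CMType F), ℕ → Prop)
    (C : ∀ (F : CMField) (ι₁ : F →+* ℂ) (V : HermSpace3 F ι₁) (Φ : CMType F), Sec42Data (honestP5Of h F ι₁ V Φ) (iso F ι₁ V Φ))
    (R : ∀ (F : CMField) (ι₁ : F →+* ℂ) (V : HermSpace3 F ι₁) (Φ : CMType F), Thm418Rest (C F ι₁ V Φ))
    (hLiu : ∀ (F : CMField), IsGalois ℚ F → 6 ≤ Module.finrank ℚ F → ∀ (Φ : CMType F) (ι₁ : F →+* ℂ), ι₁ ∈ Φ.1 →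
      ∀ V : HermSpace3 F ι₁, Thm418AsPrinted (toThm418Data (C F ι₁ V Φ) (R F ι₁ V Φ)))
    (hObj : ∀ (F : CMField), IsGalois ℚ F → 6 ≤ Module.finrank ℚ F → ∀ (Φ : CMType F) (ι₁ : F →+* ℂ), ι₁ ∈ Φ.1 →
      ∀ V : HermSpace3 F ι₁, Nonempty (toThm418Data (C F ι₁ V Φ) (R F ι₁ V Φ)).Obj)
    (hChi : ∀ (F : CMField), IsGalois ℚ F → 6 ≤ Module.finrank ℚ F → ∀ (Φ : CMType F) (ι₁ : F →+* ℂ), ι₁ ∈ Φ.1 →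
      ∀ V : HermSpace3 F ι₁, Nonempty (toThm418Data (C F ι₁ V Φ) (R F ι₁ V Φ)).Chi)
    (hirr : ∀ (F : CMField), IsGalois ℚ F → 6 ≤ Module.finrank ℚ F → ∀ (Φ : CMType F) (ι₁ : F →+* ℂ), ι₁ ∈ Φ.1 →
      ∀ (V : HermSpace3 F ι₁) (i : (toThm418Data (C F ι₁ V Φ) (R F ι₁ V Φ)).AdmIndex), ((toThm418Data (C F ι₁ V Φ) (R F ι₁ V Φ)).rhoAt i).IsIrreducible)
    (hsm : ∀ (F : CMField), IsGalois ℚ F → 6 ≤ Module.finrank ℚ F → ∀ (Φ : CMType F) (ι₁ : F →+* ℂ), ι₁ ∈ Φ.1 →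
      ∀ (V : HermSpace3 F ι₁) (i : (toThm418Data (C F ι₁ V Φ) (R F ι₁ V Φ)).AdmIndex) (v : (toThm418Data (C F ι₁ V Φ) (R F ι₁ V Φ)).omegaAt i),
        ∃ S : Subgroup (toThm418Data (C F ι₁ V Φ) (R F ι₁ V Φ)).G, IsOpen (S : Set (toThm418Data (C F ι₁ V Φ) (R F ι₁ V Φ)).G) ∧ ∀ k ∈ S, (toThm418Data (C F ι₁ V Φ) (R F ι₁ V Φ)).rhoAt i k v = v)
    (hμ : ∀ (F : CMField), IsGalois ℚ F → 6 ≤ Module.finrank ℚ F → ∀ (Φ : CMType F) (ι₁ : F →+* ℂ), ι₁ ∈ Φ.1 →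
      ∀ (V : HermSpace3 F ι₁) (g : F ≃ₐ[ℚ] F),
        ι₁.comp (g : F →+* F) ∈ (toThm418Data (C F ι₁ V Φ) (R F ι₁ V Φ)).cmType.1 ↔ ι₁.comp (g.symm : F →+* F) ∈ Φ.1)
    (i : ∀ (F : CMField) (ι₁ : F →+* ℂ) (V : HermSpace3 F ι₁) (Φ : CMType F) (Dμ : (toThm418Data (C F ι₁ V Φ) (R F ι₁ V Φ)).Obj),
      muAlgValueField F (toThm418Data (C F ι₁ V Φ) (R F ι₁ V Φ)).μ →+* ((R F ι₁ V Φ).Aμ Dμ).endAlgebra)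
    (hdim : ∀ (F : CMField) [IsGalois ℚ F], 6 ≤ Module.finrank ℚ F → ∀ (Φ : CMType F) (ι₁ : F →+* ℂ), ι₁ ∈ Φ.1 →
      ∀ (V : HermSpace3 F ι₁) (Dμ : (toThm418Data (C F ι₁ V Φ) (R F ι₁ V Φ)).Obj),
        Module.finrank ℚ (muAlgValueField F (toThm418Data (C F ι₁ V Φ) (R F ι₁ V Φ)).μ) = 2 * ((R F ι₁ V Φ).Aμ Dμ).dim)
    (hdet45 : ∀ (F : CMField) [IsGalois ℚ F], 6 ≤ Module.finrank ℚ F → ∀ (Φ : CMType F) (ι₁ : F →+* ℂ), ι₁ ∈ Φ.1 →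
      ∀ (V : HermSpace3 F ι₁) (Dμ : (toThm418Data (C F ι₁ V Φ) (R F ι₁ V Φ)).Obj)
        (x : muAlgValueField F (toThm418Data (C F ι₁ V Φ) (R F ι₁ V Φ)).μ) (M : ℕ) (f : End ((R F ι₁ V Φ).Aμ Dμ)), M ≠ 0 →
        i F ι₁ V Φ Dμ x =
          algebraMap ℚ ((R F ι₁ V Φ).Aμ Dμ).endAlgebra (M : ℚ)⁻¹ * AbelianVariety.endAlgebra.of ((R F ι₁ V Φ).Aμ Dμ) f →
        LinearMap.det (AbelianVariety.cotangentMap ((R F ι₁ V Φ).Aμ Dμ) f) =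
          (M : F) ^ ((R F ι₁ V Φ).Aμ Dμ).dim * Def45.eta (AlgHom.id ℚ F) ι₁ (toThm418Data (C F ι₁ V Φ) (R F ι₁ V Φ)).isConjugateSymplectic x) :
    (picardCMUniverse hHD hI h₁ h₃).FaceSupply :=
  faceSupply_of_thm418AsPrinted_glue_unif_along hHD hI h₁ h₃ (fun _ ι₁ => (starRingEnd ℂ).comp ι₁) (honestP5Of h) iso C R
    hLiu hObj hChi hirr hsm
    -- the choice `Φ_μ = Φ^{*ι₁}` read at `ῑ₁` (tr-prover-2's `isInverse_starRingEnd_comp_iff`, `Item2HoldsConj.lean`)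
    (fun F hG h6 Φ ι₁ hι V =>
      (Transposition.isInverse_starRingEnd_comp_iff ι₁ Φ (toThm418Data (C F ι₁ V Φ) (R F ι₁ V Φ)).cmType).mpr (hμ F hG h6 Φ ι₁ hι V))
    -- the CM half: hcmisog-isog-2's σ-parametric Core theorem at `σ := ῑ₁`, its inputs `hW`/`hdetBC` BY NAME, and Def. 4.5 (2)'s first
    -- bullet moved from `ῑ₁` to `ι₁` by `Def45.eta_starRingEnd_comp_apply` (`η_μ` does not see `ι ↦ conj ∘ ι`, `Def45EtaConjugate.lean`)
    (fun F _ h6 Φ ι₁ hι V Dμ incl hincl =>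
      exists_isogeny_isCMTypeRealisation_baseChange_of_det45 cotangent_hodge10_comparison_holds
        (fun _ _ L _ _ _ u => AbelianVariety.det_cotangentMap_baseChange L u)
        ((starRingEnd ℂ).comp ι₁) (toThm418Data (C F ι₁ V Φ) (R F ι₁ V Φ)).isConjugateSymplectic ((R F ι₁ V Φ).Aμ Dμ)
        (i F ι₁ V Φ Dμ) (hdim F h6 Φ ι₁ hι V Dμ)
        (fun x M f hM hx => by
          rw [Def45.eta_starRingEnd_comp_apply]
          exact hdet45 F h6 Φ ι₁ hι V Dμ x M f hM hx)
        incl hincl)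
    (hUnif_holds h) (hAlb_holds hA (fun _ ι₁ => (starRingEnd ℂ).comp ι₁) (honestP5Of h) iso C)

/-! ## §2  THE INTEGRATED END DISPLAY on the universe of record, `hD` dictionary form (for comparison with p299635 :257 / p303619 :206;
(β) «stronger than consumed» per tgtbt-1 D9 — the display to CITE is §3) -/

/-- **END DISPLAY at the Appendix-C datum of record along `ῑ₁`, both pinning halves substituted by name** (`hU : U = U_rec`, instantiate
with `rfl`): `HC_CM` from the two CITES `h` ([Deligne1979] canonical model, x1 `exists_recordSystem`) and `hA` ([Liu2021] §2.1 + [FGA VI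
3.3 (iii)], `albanese_baseChange_isLimit_fan_jacobian`), the POSITED Appendix-C carriers `iso`/`C`/`R`, THE CITE `hLiu` ([Liu2021] Thm. 4.18
AS PRINTED at `toThm418Data (C …) (R …)`), the printed-elsewhere carriers `hObj`/`hChi`/`hirr`/`hsm`, the choice `hμ`, Liu's Def. 4.5 (2)
DATA `i`/`hdim`/`hdet45` on `A_μ` read at `ι₁` (the record display's texts), and `hD` [ROW HD] (items (iii)+(v) at `Θ := Uiso`,
`Item6HoldsRec.lean` :211–226 VERBATIM).
Composition: `hc_cm_of_supply_of_dictionary_of_eq _ rfl ∘ exists_supplyWitness_of_faceSupply ∘ §1`.  [GR91 Prop. 3.1.1] does not enter.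
HC_CM is NOT proved: `h`, `hA`, `hLiu`, the Liu-side carriers/readings and `hD` are not inhabited here.
[cite: Liu2021, Thm. 4.18 (FJcycle.tex l. 2232–2245), Def. 4.5 (1)–(2) (l. 1936–1951), §4.2 l. 2053–2074 and Prop. C.5 (l. 4627–4637)]
[cite: Deligne1979ShimuraVarieties, §2.1.2 and 2.2.5] -/
theorem hc_cm_of_thm418AsPrinted_along_conj_holds (U : Universe)
    (hU : U = picardCMUniverse exists_isReal_hodgeModel_holds hodgePQ_independent_of_hodgeModel_holds
      BallQuotient.ballQuotientUniformised_holds cmAbelianVarietyRealised_holds)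
    (h : exists_recordSystem) (hA : albanese_baseChange_isLimit_fan_jacobian)
    (iso : ∀ (F : CMField) (ι₁ : F →+* ℂ) (_ : HermSpace3 F ι₁) (_ : CMType F), ℕ → Prop)
    (C : ∀ (F : CMField) (ι₁ : F →+* ℂ) (V : HermSpace3 F ι₁) (Φ : CMType F), Sec42Data (honestP5Of h F ι₁ V Φ) (iso F ι₁ V Φ))
    (R : ∀ (F : CMField) (ι₁ : F →+* ℂ) (V : HermSpace3 F ι₁) (Φ : CMType F), Thm418Rest (C F ι₁ V Φ))
    (hLiu : ∀ (F : CMField), IsGalois ℚ F → 6 ≤ Module.finrank ℚ F → ∀ (Φ : CMType F) (ι₁ : F →+* ℂ), ι₁ ∈ Φ.1 →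
      ∀ V : HermSpace3 F ι₁, Thm418AsPrinted (toThm418Data (C F ι₁ V Φ) (R F ι₁ V Φ)))
    (hObj : ∀ (F : CMField), IsGalois ℚ F → 6 ≤ Module.finrank ℚ F → ∀ (Φ : CMType F) (ι₁ : F →+* ℂ), ι₁ ∈ Φ.1 →
      ∀ V : HermSpace3 F ι₁, Nonempty (toThm418Data (C F ι₁ V Φ) (R F ι₁ V Φ)).Obj)
    (hChi : ∀ (F : CMField), IsGalois ℚ F → 6 ≤ Module.finrank ℚ F → ∀ (Φ : CMType F) (ι₁ : F →+* ℂ), ι₁ ∈ Φ.1 →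
      ∀ V : HermSpace3 F ι₁, Nonempty (toThm418Data (C F ι₁ V Φ) (R F ι₁ V Φ)).Chi)
    (hirr : ∀ (F : CMField), IsGalois ℚ F → 6 ≤ Module.finrank ℚ F → ∀ (Φ : CMType F) (ι₁ : F →+* ℂ), ι₁ ∈ Φ.1 →
      ∀ (V : HermSpace3 F ι₁) (i : (toThm418Data (C F ι₁ V Φ) (R F ι₁ V Φ)).AdmIndex), ((toThm418Data (C F ι₁ V Φ) (R F ι₁ V Φ)).rhoAt i).IsIrreducible)
    (hsm : ∀ (F : CMField), IsGalois ℚ F → 6 ≤ Module.finrank ℚ F → ∀ (Φ : CMType F) (ι₁ : F →+* ℂ), ι₁ ∈ Φ.1 →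
      ∀ (V : HermSpace3 F ι₁) (i : (toThm418Data (C F ι₁ V Φ) (R F ι₁ V Φ)).AdmIndex) (v : (toThm418Data (C F ι₁ V Φ) (R F ι₁ V Φ)).omegaAt i),
        ∃ S : Subgroup (toThm418Data (C F ι₁ V Φ) (R F ι₁ V Φ)).G, IsOpen (S : Set (toThm418Data (C F ι₁ V Φ) (R F ι₁ V Φ)).G) ∧ ∀ k ∈ S, (toThm418Data (C F ι₁ V Φ) (R F ι₁ V Φ)).rhoAt i k v = v)
    (hμ : ∀ (F : CMField), IsGalois ℚ F → 6 ≤ Module.finrank ℚ F → ∀ (Φ : CMType F) (ι₁ : F →+* ℂ), ι₁ ∈ Φ.1 →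
      ∀ (V : HermSpace3 F ι₁) (g : F ≃ₐ[ℚ] F),
        ι₁.comp (g : F →+* F) ∈ (toThm418Data (C F ι₁ V Φ) (R F ι₁ V Φ)).cmType.1 ↔ ι₁.comp (g.symm : F →+* F) ∈ Φ.1)
    (i : ∀ (F : CMField) (ι₁ : F →+* ℂ) (V : HermSpace3 F ι₁) (Φ : CMType F) (Dμ : (toThm418Data (C F ι₁ V Φ) (R F ι₁ V Φ)).Obj),
      muAlgValueField F (toThm418Data (C F ι₁ V Φ) (R F ι₁ V Φ)).μ →+* ((R F ι₁ V Φ).Aμ Dμ).endAlgebra)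
    (hdim : ∀ (F : CMField) [IsGalois ℚ F], 6 ≤ Module.finrank ℚ F → ∀ (Φ : CMType F) (ι₁ : F →+* ℂ), ι₁ ∈ Φ.1 →
      ∀ (V : HermSpace3 F ι₁) (Dμ : (toThm418Data (C F ι₁ V Φ) (R F ι₁ V Φ)).Obj),
        Module.finrank ℚ (muAlgValueField F (toThm418Data (C F ι₁ V Φ) (R F ι₁ V Φ)).μ) = 2 * ((R F ι₁ V Φ).Aμ Dμ).dim)
    (hdet45 : ∀ (F : CMField) [IsGalois ℚ F], 6 ≤ Module.finrank ℚ F → ∀ (Φ : CMType F) (ι₁ : F →+* ℂ), ι₁ ∈ Φ.1 →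
      ∀ (V : HermSpace3 F ι₁) (Dμ : (toThm418Data (C F ι₁ V Φ) (R F ι₁ V Φ)).Obj)
        (x : muAlgValueField F (toThm418Data (C F ι₁ V Φ) (R F ι₁ V Φ)).μ) (M : ℕ) (f : End ((R F ι₁ V Φ).Aμ Dμ)), M ≠ 0 →
        i F ι₁ V Φ Dμ x =
          algebraMap ℚ ((R F ι₁ V Φ).Aμ Dμ).endAlgebra (M : ℚ)⁻¹ * AbelianVariety.endAlgebra.of ((R F ι₁ V Φ).Aμ Dμ) f →
        LinearMap.det (AbelianVariety.cotangentMap ((R F ι₁ V Φ).Aμ Dμ) f) =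
          (M : F) ^ ((R F ι₁ V Φ).Aμ Dμ).dim * Def45.eta (AlgHom.id ℚ F) ι₁ (toThm418Data (C F ι₁ V Φ) (R F ι₁ V Φ)).isConjugateSymplectic x)
    (hD : ∀ (F : CMField), IsGalois ℚ F → 6 ≤ Module.finrank ℚ F → ∀ (f : Face F) (ι₁ : F →+* ℂ), f.Admissible ι₁ →
      ∀ V : HermSpace3 F ι₁,
        ∃ (HG : Type) (_ : NormedAddCommGroup HG) (_ : InnerProductSpace ℂ HG)
          (emb : ∀ Γ : Level V, U.CohC (U.pms F ι₁ V Γ) 2 →ₗ[ℂ] HG)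
          (cover : ∀ (Γ Γ' : Level V), Γ' ≤ Γ → U.Mor (U.pms F ι₁ V Γ') (U.pms F ι₁ V Γ)),
          (∀ (Γ : Level V) (ω₁ ω₂ : U.CohC (U.pms F ι₁ V Γ) 1), ω₁ ∈ U.Uiso Γ F (f.psi 0) ι₁ → ω₂ ∈ U.Uiso Γ F (f.psi 1) ι₁ →
            emb Γ (U.cup2C (U.pms F ι₁ V Γ) 1 ω₁ ω₂) ∈ (Submodule.span ℂ
              {x : HG | ∃ (Γ' : Level V), ∃ ω₃ ∈ U.Uiso Γ' F (f.psi 2) ι₁, ∃ ω₄ ∈ U.Uiso Γ' F (f.psi 3) ι₁,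
                x = emb Γ' (U.cup2C (U.pms F ι₁ V Γ') 1 ω₃ ω₄)}).topologicalClosure) ∧
          (∀ (Γ Γ' : Level V) (hle : Γ' ≤ Γ) (x : U.CohC (U.pms F ι₁ V Γ) 2),
            emb Γ' (U.pullC (cover Γ Γ' hle) 2 x) = emb Γ x) ∧
          (∀ Γ : Level V, ∃ c : ℂ, c ≠ 0 ∧ ∀ x y : U.CohC (U.pms F ι₁ V Γ) 2,
            x ∈ (U.hodge (U.pms F ι₁ V Γ) 2).F 2 → y ∈ (U.hodge (U.pms F ι₁ V Γ) 2).F 2 →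
              ⟪emb Γ y, emb Γ x⟫_ℂ = c * U.trC (U.pms F ι₁ V Γ) 4 (U.cup2C (U.pms F ι₁ V Γ) 2 x (conj y)))) :
    HC_CM := by
  subst hU
  exact hc_cm_of_supply_of_dictionary_of_eq _ rfl
    (exists_supplyWitness_of_faceSupply _ _ _ _
      (faceSupply_of_thm418AsPrinted_along_conj_holds _ _ _ _ h hA iso C R hLiu hObj hChi hirr hsm hμ i hdim hdet45)) hD

/-! ## §3  THE (β)-FREE END DISPLAY, MEETING FORM, on the universe of record (the form to cite; tgtbt-1 §6 (i) / D9, cite-2 §18) -/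

section MeetingForm

open MeasureTheory
open Prior.Perl34File (Perl34.IsolationSetting)
open Prior.Perl34File.Perl34

/-- **END DISPLAY, (β)-FREE MEETING FORM, on the universe OF RECORD** (`let U := U_rec`): §1 composed BY NAME with
`hc_cm_of_supply_of_settingMeetSat_embOf` (`B01/FaceWedgeOverlapBypassMeeting.lean` :257 at the four `_holds` data and
`deligneMilne1982_Thm_6_20_full_holds`; the pattern of own-htheta's p300636 :278 and b01-x2's p301318 :71, own-htheta NAMING
pub-hodgecm2/INBOX 2026-08-21T21:35:47Z «the (β)-free END twin … cheapest place: one extra theorem in the Holds file»).  Displayed hypotheses =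
EXACTLY the §1 binders {`h`, `hA`, `iso`, `C`, `R`, `hLiu`, `hObj`, `hChi`, `hirr`, `hsm`, `hμ`, `i`, `hdim`, `hdet45`} + the theta-side
meeting binder `hM` over `Model.embOf` (b01-x2's text, VERBATIM at `U_rec`) — NO `hD`, no `HG`/`emb`/`cover` data, no clause (α)/(β)/(γ).
This is the END display of this file to CITE; §2 (the `hD` dictionary form) is kept for comparison with the earlier END displays and is
graded «(β) stronger than consumed» by the red team (tgtbt-1 D9, cite-2 §18 on p303619 :206).  [GR91 Prop. 3.1.1] does not enter.
HC_CM is NOT proved: `h`, `hA`, `hLiu`, the Liu-side carriers/readings and `hM` are not inhabited here.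
[cite: Liu2021, Thm. 4.18 (FJcycle.tex l. 2232–2245), Def. 4.5 (1)–(2) (l. 1936–1951), §4.2 l. 2053–2074 and Prop. C.5 (l. 4627–4637)]
[cite: Deligne1979ShimuraVarieties, §2.1.2 and 2.2.5] -/
theorem hc_cm_of_thm418AsPrinted_along_conj_holds_meeting_rec
    (h : exists_recordSystem) (hA : albanese_baseChange_isLimit_fan_jacobian)
    (iso : ∀ (F : CMField) (ι₁ : F →+* ℂ) (_ : HermSpace3 F ι₁) (_ : CMType F), ℕ → Prop)
    (C : ∀ (F : CMField) (ι₁ : F →+* ℂ) (V : HermSpace3 F ι₁) (Φ : CMType F), Sec42Data (honestP5Of h F ι₁ V Φ) (iso F ι₁ V Φ))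
    (R : ∀ (F : CMField) (ι₁ : F →+* ℂ) (V : HermSpace3 F ι₁) (Φ : CMType F), Thm418Rest (C F ι₁ V Φ))
    (hLiu : ∀ (F : CMField), IsGalois ℚ F → 6 ≤ Module.finrank ℚ F → ∀ (Φ : CMType F) (ι₁ : F →+* ℂ), ι₁ ∈ Φ.1 →
      ∀ V : HermSpace3 F ι₁, Thm418AsPrinted (toThm418Data (C F ι₁ V Φ) (R F ι₁ V Φ)))
    (hObj : ∀ (F : CMField), IsGalois ℚ F → 6 ≤ Module.finrank ℚ F → ∀ (Φ : CMType F) (ι₁ : F →+* ℂ), ι₁ ∈ Φ.1 →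
      ∀ V : HermSpace3 F ι₁, Nonempty (toThm418Data (C F ι₁ V Φ) (R F ι₁ V Φ)).Obj)
    (hChi : ∀ (F : CMField), IsGalois ℚ F → 6 ≤ Module.finrank ℚ F → ∀ (Φ : CMType F) (ι₁ : F →+* ℂ), ι₁ ∈ Φ.1 →
      ∀ V : HermSpace3 F ι₁, Nonempty (toThm418Data (C F ι₁ V Φ) (R F ι₁ V Φ)).Chi)
    (hirr : ∀ (F : CMField), IsGalois ℚ F → 6 ≤ Module.finrank ℚ F → ∀ (Φ : CMType F) (ι₁ : F →+* ℂ), ι₁ ∈ Φ.1 →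
      ∀ (V : HermSpace3 F ι₁) (i : (toThm418Data (C F ι₁ V Φ) (R F ι₁ V Φ)).AdmIndex), ((toThm418Data (C F ι₁ V Φ) (R F ι₁ V Φ)).rhoAt i).IsIrreducible)
    (hsm : ∀ (F : CMField), IsGalois ℚ F → 6 ≤ Module.finrank ℚ F → ∀ (Φ : CMType F) (ι₁ : F →+* ℂ), ι₁ ∈ Φ.1 →
      ∀ (V : HermSpace3 F ι₁) (i : (toThm418Data (C F ι₁ V Φ) (R F ι₁ V Φ)).AdmIndex) (v : (toThm418Data (C F ι₁ V Φ) (R F ι₁ V Φ)).omegaAt i),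
        ∃ S : Subgroup (toThm418Data (C F ι₁ V Φ) (R F ι₁ V Φ)).G, IsOpen (S : Set (toThm418Data (C F ι₁ V Φ) (R F ι₁ V Φ)).G) ∧ ∀ k ∈ S, (toThm418Data (C F ι₁ V Φ) (R F ι₁ V Φ)).rhoAt i k v = v)
    (hμ : ∀ (F : CMField), IsGalois ℚ F → 6 ≤ Module.finrank ℚ F → ∀ (Φ : CMType F) (ι₁ : F →+* ℂ), ι₁ ∈ Φ.1 →
      ∀ (V : HermSpace3 F ι₁) (g : F ≃ₐ[ℚ] F),
        ι₁.comp (g : F →+* F) ∈ (toThm418Data (C F ι₁ V Φ) (R F ι₁ V Φ)).cmType.1 ↔ ι₁.comp (g.symm : F →+* F) ∈ Φ.1)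
    (i : ∀ (F : CMField) (ι₁ : F →+* ℂ) (V : HermSpace3 F ι₁) (Φ : CMType F) (Dμ : (toThm418Data (C F ι₁ V Φ) (R F ι₁ V Φ)).Obj),
      muAlgValueField F (toThm418Data (C F ι₁ V Φ) (R F ι₁ V Φ)).μ →+* ((R F ι₁ V Φ).Aμ Dμ).endAlgebra)
    (hdim : ∀ (F : CMField) [IsGalois ℚ F], 6 ≤ Module.finrank ℚ F → ∀ (Φ : CMType F) (ι₁ : F →+* ℂ), ι₁ ∈ Φ.1 →
      ∀ (V : HermSpace3 F ι₁) (Dμ : (toThm418Data (C F ι₁ V Φ) (R F ι₁ V Φ)).Obj),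
        Module.finrank ℚ (muAlgValueField F (toThm418Data (C F ι₁ V Φ) (R F ι₁ V Φ)).μ) = 2 * ((R F ι₁ V Φ).Aμ Dμ).dim)
    (hdet45 : ∀ (F : CMField) [IsGalois ℚ F], 6 ≤ Module.finrank ℚ F → ∀ (Φ : CMType F) (ι₁ : F →+* ℂ), ι₁ ∈ Φ.1 →
      ∀ (V : HermSpace3 F ι₁) (Dμ : (toThm418Data (C F ι₁ V Φ) (R F ι₁ V Φ)).Obj)
        (x : muAlgValueField F (toThm418Data (C F ι₁ V Φ) (R F ι₁ V Φ)).μ) (M : ℕ) (f : End ((R F ι₁ V Φ).Aμ Dμ)), M ≠ 0 →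
        i F ι₁ V Φ Dμ x =
          algebraMap ℚ ((R F ι₁ V Φ).Aμ Dμ).endAlgebra (M : ℚ)⁻¹ * AbelianVariety.endAlgebra.of ((R F ι₁ V Φ).Aμ Dμ) f →
        LinearMap.det (AbelianVariety.cotangentMap ((R F ι₁ V Φ).Aμ Dμ) f) =
          (M : F) ^ ((R F ι₁ V Φ).Aμ Dμ).dim * Def45.eta (AlgHom.id ℚ F) ι₁ (toThm418Data (C F ι₁ V Φ) (R F ι₁ V Φ)).isConjugateSymplectic x) :
    let U := picardCMUniverse exists_isReal_hodgeModel_holds hodgePQ_independent_of_hodgeModel_holds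
      BallQuotient.ballQuotientUniformised_holds cmAbelianVarietyRealised_holds
    let hU := ballQuotientUniformisedDatum_of BallQuotient.ballQuotientUniformised_holds
    (∀ (F : CMField), IsGalois ℚ F → 6 ≤ Module.finrank ℚ F → ∀ (f : Face F) (ι₁ : F →+* ℂ), f.Admissible ι₁ →
      ∀ V : HermSpace3 F ι₁,
      ∃ (H CG G SK SigIdx SigIdxG : Type) (_ : NormedAddCommGroup H) (_ : InnerProductSpace ℂ H) (_ : CompleteSpace H)
        (_ : NormedAddCommGroup CG) (_ : NormedSpace ℂ CG) (_ : Group G) (_ : TopologicalSpace G) (_ : TopologicalSpace SK)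
        (S : Perl34.IsolationSetting H (Lp ℂ 2 V.autMeasure) CG G SK SigIdx SigIdxG),
        (∀ (Γ : Level V) (ω₁ ω₂ : U.CohC (U.pms F ι₁ V Γ) 1),
          ω₁ ∈ U.Uiso Γ F (f.psi 0) ι₁ → ω₂ ∈ U.Uiso Γ F (f.psi 1) ι₁ →
            embOf exists_isReal_hodgeModel_holds hodgePQ_independent_of_hodgeModel_holds hU cmAbelianVarietyRealised_holds Γ
                (U.cup2C (U.pms F ι₁ V Γ) 1 ω₁ ω₂) ≠ 0 →
              ∃ u ∈ S.t12.S12,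
                ⟪embOf exists_isReal_hodgeModel_holds hodgePQ_independent_of_hodgeModel_holds hU cmAbelianVarietyRealised_holds Γ
                    (U.cup2C (U.pms F ι₁ V Γ) 1 ω₁ ω₂), u⟫_ℂ ≠ 0) ∧
        (∀ χ : S.t34.X, S.t34.allowed χ → ∀ (Φ : SK) (Γ₁ : Level V)
          (ω₁ ω₂ : U.CohC (U.pms F ι₁ V Γ₁) 1),
          ω₁ ∈ U.Uiso Γ₁ F (f.psi 0) ι₁ →
          ω₂ ∈ U.Uiso Γ₁ F (f.psi 1) ι₁ →
            ⟪embOf exists_isReal_hodgeModel_holds hodgePQ_independent_of_hodgeModel_holds hU cmAbelianVarietyRealised_holds Γ₁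
                (U.cup2C (U.pms F ι₁ V Γ₁) 1 ω₁ ω₂),
              S.t34.ϑ χ Φ⟫_ℂ ≠ 0 →
              ∃ (Γ : Level V) (ω : Fin 4 → U.CohC (U.pms F ι₁ V Γ) 1),
                (∀ i, ω i ∈ U.Uiso Γ F (f.psi i) ι₁) ∧
                  ⟪embOf exists_isReal_hodgeModel_holds hodgePQ_independent_of_hodgeModel_holds hU cmAbelianVarietyRealised_holds Γ
                      (U.cup2C (U.pms F ι₁ V Γ) 1 (ω 2) (ω 3)),
                    embOf exists_isReal_hodgeModel_holds hodgePQ_independent_of_hodgeModel_holds hU cmAbelianVarietyRealised_holds Γ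
                      (U.cup2C (U.pms F ι₁ V Γ) 1 (ω 0) (ω 1))⟫_ℂ
                    ≠ 0)) →
    HC_CM :=
  fun hM ↦ hc_cm_of_supply_of_settingMeetSat_embOf exists_isReal_hodgeModel_holds hodgePQ_independent_of_hodgeModel_holds
    BallQuotient.ballQuotientUniformised_holds cmAbelianVarietyRealised_holds deligneMilne1982_Thm_6_20_full_holds
    (faceSupply_of_thm418AsPrinted_along_conj_holds _ _ _ _ h hA iso C R hLiu hObj hChi hirr hsm hμ i hdim hdet45) hM

end MeetingForm

end Summit.HodgeConjecture.CorCM.Model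

end
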